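import Mathlib.Logic.Equiv.Fintype
import Mathlib.Data.Fintype.CardEmbedding
import Summits.CriticalPhenomena.PercolationContinuityZ3.Theorems.PercNearOneGluingNoHeavyLowerTailSahiSlotPatternBridge

/-!
# The fibration of permutation tuples over their restriction to a set of slots

Support file (lane `prim-masterthm-p3`, generation 18; `--supports stmt-CriticalPhenomena-4575`).  Pure proofs, no definitions,
no `sorry`, standard axioms.

The sums of the pattern programme run over `d`-tuples of permutations `τ ∈ S_N^d`; a block expansion through a slot leaves a
summand depending only on the restriction of `τ` to `k` of the `N` slots (`τ_a ∘ ι`, `ι : Fin k ↪ Fin N`).  This file proves the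
fibration identity
  `Σ_{τ ∈ S_N^d} Φ(a ↦ τ_a ∘ ι) = ((N − k)!)^d · Σ_{u injective on every axis} Φ(u)`        (`sum_perm_comp_eq`),
from the single-axis count `#{σ ∈ S_N : σ ∘ ι = v} = (N − k)!` for every injective `v` (`card_perm_comp_eq`; transitivity of `S_N` on
injections via `Equiv.extendSubtype`, and `N! = (N−k)! · N^{(k)}` with `‖Fin k ↪ Fin N‖ = N^{(k)}`).  Together with
`…SahiSlotPatternRestrict` (injective families = monotone skeletons × `S_k^d`) it turns every such restricted sum into
`((N−k)!)^d · Σ_{skeletons} patternForm d k (⋯)` — the deletion step of the SIGN⁻ law and of the branching rule (HIERARCHY §26(j)).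
[this work]
-/

namespace Summit.CriticalPhenomena.PercolationContinuityZ3.Theorems

open Finset Function Equiv Equiv.Perm

namespace SahiSlot

section Fibre

open scoped Classical

variable {k N : ℕ}

/-- `S_N` acts transitively on injections `Fin k → Fin N`: some permutation carries `v` to `v'`. [this work] -/
theorem exists_perm_comp_eq {v v' : Fin k → Fin N} (hv : Injective v) (hv' : Injective v') :
    ∃ ρ : Perm (Fin N), (ρ : Fin N → Fin N) ∘ v = v' := by
  let e : {x // x ∈ Set.range v} ≃ {x // x ∈ Set.range v'} :=
    (Function.Embedding.toEquivRange ⟨v, hv⟩).symm.trans (Function.Embedding.toEquivRange ⟨v', hv'⟩)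
  refine ⟨e.extendSubtype, funext fun i => ?_⟩
  simp only [comp_apply]
  rw [e.extendSubtype_apply_of_mem _ (Set.mem_range_self i)]
  have h1 : (Function.Embedding.toEquivRange ⟨v, hv⟩).symm ⟨v i, Set.mem_range_self i⟩ = i := by
    rw [Equiv.symm_apply_eq, Function.Embedding.toEquivRange_apply]
    rfl
  show ((Function.Embedding.toEquivRange ⟨v', hv'⟩) ((Function.Embedding.toEquivRange ⟨v, hv⟩).symm ⟨v i, _⟩) : Fin N) = v' i
  rw [h1, Function.Embedding.toEquivRange_apply]
  rfl

/-- All fibres of `σ ↦ σ ∘ ι` over injective maps have the same size. [this work] -/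
theorem card_perm_comp_eq_card (ι : Fin k → Fin N) {v v' : Fin k → Fin N} (hv : Injective v) (hv' : Injective v') :
    (univ.filter fun σ : Perm (Fin N) => (σ : Fin N → Fin N) ∘ ι = v).card =
      (univ.filter fun σ : Perm (Fin N) => (σ : Fin N → Fin N) ∘ ι = v').card := by
  -- left multiplication by a permutation carrying `v` to `v'` (and back)
  have key : ∀ {w w' : Fin k → Fin N}, Injective w → Injective w' →
      (univ.filter fun σ : Perm (Fin N) => (σ : Fin N → Fin N) ∘ ι = w).card ≤
        (univ.filter fun σ : Perm (Fin N) => (σ : Fin N → Fin N) ∘ ι = w').card := by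
    intro w w' hw hw'
    obtain ⟨ρ, hρ⟩ := exists_perm_comp_eq hw hw'
    refine Finset.card_le_card_of_injOn (fun σ => ρ * σ) (fun σ hσ => ?_) ?_
    · rw [mem_coe, mem_filter] at hσ ⊢
      refine ⟨mem_univ _, ?_⟩
      rw [← hρ, ← hσ.2]
      rfl
    · intro σ _ σ' _ h
      exact mul_left_cancel h
  exact le_antisymm (key hv hv') (key hv' hv)

/-- **The single-axis count**: for an injective position map `ι : Fin k → Fin N` and an injective `v`,
`#{σ ∈ S_N : σ ∘ ι = v} = (N − k)!`. [this work] -/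
theorem card_perm_comp_eq {ι : Fin k → Fin N} (hι : Injective ι) {v : Fin k → Fin N} (hv : Injective v) :
    (univ.filter fun σ : Perm (Fin N) => (σ : Fin N → Fin N) ∘ ι = v).card = (N - k).factorial := by
  have hkN : k ≤ N := by simpa using Fintype.card_le_of_injective v hv
  -- sum of the (equal) fibre sizes over the injective maps is `N!`
  set Inj : Finset (Fin k → Fin N) := univ.filter fun w => Injective w with hInj
  have hmaps : ((univ : Finset (Perm (Fin N))) : Set (Perm (Fin N))).MapsTo
      (fun σ : Perm (Fin N) => (σ : Fin N → Fin N) ∘ ι) Inj := by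
    intro σ _
    rw [mem_coe, hInj, mem_filter]
    exact ⟨mem_univ _, σ.injective.comp hι⟩
  have htot := card_eq_sum_card_fiberwise hmaps
  rw [card_univ, Fintype.card_perm, Fintype.card_fin] at htot
  have hconst : ∀ w ∈ Inj, (univ.filter fun σ : Perm (Fin N) => (σ : Fin N → Fin N) ∘ ι = w).card =
      (univ.filter fun σ : Perm (Fin N) => (σ : Fin N → Fin N) ∘ ι = v).card := by
    intro w hw
    rw [hInj, mem_filter] at hw
    exact card_perm_comp_eq_card ι hw.2 hv
  rw [sum_congr rfl hconst, sum_const, smul_eq_mul] at htot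
  -- the number of injective maps is the descending factorial
  have hcardInj : Inj.card = N.descFactorial k := by
    have h1 : Inj.card = Fintype.card {w : Fin k → Fin N // Injective w} := by
      rw [hInj, Fintype.card_subtype]
    rw [h1, Fintype.card_congr (Equiv.subtypeInjectiveEquivEmbedding (Fin k) (Fin N)), Fintype.card_embedding_eq]
    simp
  rw [hcardInj] at htot
  -- `N! = (N-k)! · N^{(k)}` and `N^{(k)} ≠ 0`
  have hfact := Nat.factorial_mul_descFactorial hkN
  have hpos : 0 < N.descFactorial k := Nat.descFactorial_pos.2 hkN
  have : N.descFactorial k * (univ.filter fun σ : Perm (Fin N) => (σ : Fin N → Fin N) ∘ ι = v).card =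
      N.descFactorial k * (N - k).factorial := by
    rw [← htot, mul_comm, hfact]
  exact Nat.eq_of_mul_eq_mul_left hpos this

variable {d : ℕ}

/-- **THE FIBRATION IDENTITY**: `Σ_{τ ∈ S_N^d} Φ(a ↦ τ_a ∘ ι) = ((N − k)!)^d · Σ_{u injective on every axis} Φ(u)`. [this work] -/
theorem sum_perm_comp_eq {ι : Fin k → Fin N} (hι : Injective ι) (Φ : (Fin d → Fin k → Fin N) → ℝ) :
    ∑ τ : Fin d → Perm (Fin N), Φ (fun a => (τ a : Fin N → Fin N) ∘ ι) =
      (((N - k).factorial : ℝ) ^ d) *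
        ∑ u ∈ univ.filter (fun u : Fin d → Fin k → Fin N => ∀ a, Injective (u a)), Φ u := by
  set Inj : Finset (Fin d → Fin k → Fin N) := univ.filter fun u => ∀ a, Injective (u a) with hInj
  set res : (Fin d → Perm (Fin N)) → (Fin d → Fin k → Fin N) := fun τ a => (τ a : Fin N → Fin N) ∘ ι with hres
  have hmaps : ∀ τ ∈ (univ : Finset (Fin d → Perm (Fin N))), res τ ∈ Inj := by
    intro τ _
    rw [hInj, mem_filter]
    exact ⟨mem_univ _, fun a => (τ a).injective.comp hι⟩
  rw [← sum_fiberwise_of_maps_to hmaps (fun τ => Φ (res τ)), mul_sum]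
  refine sum_congr rfl fun u hu => ?_
  rw [hInj, mem_filter] at hu
  have hfib : ∀ τ ∈ univ.filter (fun τ : Fin d → Perm (Fin N) => res τ = u), Φ (res τ) = Φ u := by
    intro τ hτ
    rw [mem_filter] at hτ
    rw [hτ.2]
  rw [sum_congr rfl hfib, sum_const, nsmul_eq_mul]
  congr 1
  -- the fibre is a product of single-axis fibres
  have hpi : univ.filter (fun τ : Fin d → Perm (Fin N) => res τ = u) =
      Fintype.piFinset fun a => univ.filter fun σ : Perm (Fin N) => (σ : Fin N → Fin N) ∘ ι = u a := by
    ext τ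
    simp only [mem_filter, mem_univ, true_and, Fintype.mem_piFinset, hres]
    exact ⟨fun h a => congrFun h a, fun h => funext h⟩
  rw [hpi, Fintype.card_piFinset, prod_congr rfl fun a _ => card_perm_comp_eq hι (hu.2 a), prod_const, card_univ,
    Fintype.card_fin]
  push_cast
  ring

end Fibre

end SahiSlot

end Summit.CriticalPhenomena.PercolationContinuityZ3.Theorems
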